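import Summits.CriticalPhenomena.CardyFormulaZ2.Theorems.CardyMagicRigidityNestingRigidityNeckCoarseReduction
import HarnessLib

/-!
# The fuzzy hook-up `Hook*` of a ball through the big blobs of its collar (stub S11, candidate approximating event)

Crux `Summit.CriticalPhenomena.CardyFormulaZ2.Theses.CardyMagicRigidity.NestingRigidity` (stmt-CriticalPhenomena-4835),
line `pinch-resampling` v4, stub S11 `stub_neckHookupCoarseT`.  The concrete candidate `E = THookStar ℓ lam s x o` for the
reduction `neckHookupCoarseT_of_approx` (`…NeckCoarseReduction`): interior connectivity is real, attachment of an interior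
open site to a big blob is "adjacent to an inner-layer vertex whose `ℓ`-cell lies in the blob's coarse footprint"; its
factorisation through (interior, coarse datum) `tHookStar_factor`; and the corollary `neckHookupCoarseT_of_tHookStar`:
S11 ⇐ `P(TPinch ∩ (THook ∆ THookStar)) ≤ b² P(TPinch)` in the scale window.  The rest of the B3 road map (sandwich,
virtual edges, covering lemmas) is in the sibling files `…NeckHookStarSandwich`, `…NeckVirtualEdges`, `…NeckCoveringA`,
`…NeckCoveringB`; the road map itself (worker S11, 2026-08-17) is reproduced below.

## B3 road map (analysis of worker S11, 2026-08-17 — for the lead's re-brief).  STATUS: items 0 and 1 below are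
## FORMALISED in the sibling files (`tPinch_inter_symmDiff_subset`, `covering_A`, `covering_B`, sorry-free); 2–4 are not.

Notation: `η` the spliced configuration on `O = Λ_{2s}(x)`, `K = Λ_s(x)`, `A = O ∖ K`; on `TPinch`, `O₁, O₂` the two open
crossing blobs; `C(·)` = `η`-open cluster inside `O`; `σ = tCoarse ℓ lam s x o η`; "big" = `triNorm`-diameter `≥ lam`;
`Hook* = THookStar`.  Throughout `2 ≤ L`, so `1 ≤ lam ≤ s/2 ≤ s - 1`, `ℓ ≤ lam/L³`, and `O₁, O₂` are big.

0. ONE-SIDED SANDWICH (deterministic, easy): `TPinch ∩ Hook(η₁) ⊆ THookStar`, where `η₁ = η` minus the small open blobs of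
   `A` touching the inner layer and `Hook(η₁)` = `O₁ ↔ O₂` through interior sites and big blobs with REAL adjacency (real
   adjacency to a big blob ⟹ touching one of its footprint cells).  Hence
   `TPinch ∩ (THook ∆ THookStar) ⊆ 𝔄 ∪ 𝔅`, `𝔄 := TPinch ∩ THookStar ∖ THook` (fuzzy chain, HONEST disconnection
   `C(O₁) ≠ C(O₂)`), `𝔅 := TPinch ∩ THook ∖ Hook(η₁)` (honest connection; the family of small inner-touching blobs is
   JOINTLY pivotal — no single one need be).
1. COVERING LEMMA (both sides; honest events only; NO planar duality if the four-arm input is taken in CLUSTER FORM).  Let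
   `ℱ` be a MINIMAL family of "bridges" — for `𝔄`: virtual edges `(K, β, C)` (interior cluster `K` touching a cell
   `C ∈ fp β` of a big blob `β`, `cl K ≠ cl β`; distinct big blobs with EQUAL coarse footprint need no "merge" bridge: a
   fuzzy step through a footprint `S` is realised inside ONE blob with footprint `S`, `stepChain_of_starPair`), locale = the
   inner-layer site of `β` in `C` (`vEdges`), scale `2ℓ`; for `𝔅`: small blobs `β` (locale `w ∈ β ∩ innerLayer`, scale
   `t = diam β < lam`) — minimal such that adding the virtual edges joins `C(O₁)` to `C(O₂)` (`𝔄`) / closing `⋃ℱ`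
   separates `O₁` from `O₂` (`𝔅`).  Then for EVERY node `𝒩` of the single-linkage hierarchy of the locales of `ℱ`
   (diameter `Δ_𝒩`, gap `Γ_𝒩` to the other locales, `Γ_root := s`):
     `TwoOpenClustersCross(w_𝒩; Δ_𝒩 + lam + 2, Γ_𝒩/2 - 1)` — two `η`-open crossings of that annulus lying in DISTINCT
     open clusters OF THE ANNULUS.
   Proof ("D_in/D_out"): along a simple connecting path, the first and the last cluster incident to a bridge of `𝒩` are
   distinct (else `𝒩` is redundant: minimality), each meets `Λ_{Δ+lam+2}(w_𝒩)` and reaches distance `≥ Γ_𝒩` (it is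
   `C(O₁)`, `C(O₂)`, or incident to a bridge outside `𝒩`), and an open connection between them inside the annulus would
   make `𝒩` redundant (`𝔄`) / splice into a route avoiding `⋃ℱ` (`𝔅`; first-entry / last-exit segments, `PathIn.exit`,
   `PathIn.last_exit`; the annulus avoids every bridge of `ℱ`; for `𝔅` enlarge the end segments by the crossing blobs
   `O₁, O₂` so that they reach the outer layer, and keep `Γ_𝒩/2 - 1 ≤ Γ_𝒩 - lam - 1`, `≤ s/2`).  DENSE CLUMPS (`𝔄`): along a
   simple connecting path the clusters alternate, every other one containing a big blob (each virtual edge has a big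
   blob on one side), so `j` bridges of `ℱ` with locales in `Λ_Δ(w)`, `Δ ≤ lam/8`, force `⌈(j+1)/2⌉` DISJOINT open crossings
   of the annulus `(2Δ + 2ℓ + 2, lam/4)` around `w`: probability `≤ (C ((Δ+ℓ)/lam)^{α₁})^{(j+1)/2}` by BK (`SiteBK`,
   `real_disjointOccurrencePow_le_pow`) and the one-arm bound — an event depending on `(w, Δ, j)` only, so dense clumps
   need NO internal enumeration (a one-arm factor per cell would lose against the entropy `lam/ℓ` per cell).  REMAINING GAP
   (`𝔅`, dense "touching necklaces"): a minimal BLOCKING family has no path structure; instead every `β ∈ ℱ` is adjacent to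
   BOTH the `v`-component `D⁻` and the `v'`-component `D⁺` of `avoidSet ℱ` (minimality: the route through `β` avoiding
   `ℱ ∖ {β}`; this is `hside` of `covering_B` with `𝒩 = {β}`).  Family blobs at mutual spacing `> (2+δ)·lam` carry the
   per-blob node event at ratio `1+δ/2` (probability `≤ 1 - c(δ)` by RSW circuits, `TriAnnulusCircuit`; independent across
   blobs), hence `q^m`; runs of `m` family blobs at spacing `< A lam` (`A = A(ε, C)` the ratio at which position entropy `A` is beaten by the
   node cost `C (4/A)^{1+ε}`; in particular "touching" runs at spacing `≤ 2 lam + 4`, which carry NO annulus event) need one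
   extra honest bound, `TouchingNecklaceBoundT` of `S11_Inputs.lean`: P(∃ family with `m` members in an `A m lam`-window,
   each adjacent to both sides) `≤ C_A q_A^m` — an RSW/planarity statement (non-crossing of
   disjoint connected site sets of `𝕋` forces the far side to "fly over" each touch-down through a collar blob) NOT reduced
   here.  Without it the union bound only gives `P(𝔅) ≤ C (lam/s)^{ε} + P(∃ touching run of length ≥ L' lam)`.
2. SUMMATION: `k = 1`: `Σ_cells π₄^{cl}(2ℓ+2, s/2-1) ≤ (6s/ℓ + 6) C ((4ℓ+4)/s)^{1+ε}` (`𝔄`) and, by monotonicity in the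
   inner radius, `(6(s+1)/lam + 6)·C'·((lam+2)/(s/2-1))^{1+ε}` (`𝔅`) — THIS is where `α₄ > 1` is intrinsic; `k ≥ 2`:
   product over hierarchy nodes by independence of events determined by disjoint annuli
   (`measureReal_inter_of_determinedBy`), with an `M`-separated clump decomposition (child factor
   `C M^{-ε}/(1 - 2^{-ε}) < 1/2`) and the BK bound for dense clumps.  Bookkeeping that closes (worked out on paper):
   skeleton = the laminar family of `M`-GOOD clumps (`Γ_Q ≥ M (D_Q + base)`, `base = 2ℓ+2` resp. `lam+1`), non-good
   structure collapsed and NOT enumerated; a good clump's children are UNORDERED (the `1/c!` beats the `c^c` of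
   sequential placement): each child contributes `≤ c·φ(M)`, `φ(M) = C' M^{-ε}/(1-2^{-ε})`, because its position at
   resolution `D_child ∨ base` within the parent, at nearest-neighbour distance `≈ d ≥ M D_child`, has `≲ c d/D_child`
   choices against the cost `(D_child/d)^{1+ε}`; so `Z(parent) ≤ Σ_{c≥2} (e φ)^c < 1` and the total is
   `≤ Σ_{D} (6s/(D ∨ base)) C ((D+base)/s)^{1+ε} Z ≤ C″ (base/s)^{ε} + (dense clumps, BK)`.  Expected total
   `≤ C″((ℓ/s)^{ε} + (lam/s)^{ε})·polylog(s/ℓ) ≤ b²` once `L = L(b)` is large; the window constraint `s³ ℓ ≤ lam⁴` is NOT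
   used (only `ℓ ≤ lam ≤ s/L`), so the registered statement is the right one (it is weaker).
3. RELATIVE FORM: `P(TPinch x x s s) ≥ c₀ > 0` for `s ≥ s₀` (RSW at ratio 2 with "exactly two crossing clusters of each
   colour"; NOT in the tree) turns the absolute bound into `≤ b²·P(TPinch)`; small `s` are excluded by taking `L ≥ s₀`.
4. INPUTS as Lean signatures.  (I4T) cluster-form two-radius four-arm bound on site `𝕋`, exponent `> 1` — ABSENT:
     `∃ ε C : ℝ, 0 < ε ∧ ∀ (r R : ℕ), 1 ≤ r → r ≤ R → (triSitePercolation half).real {ω | ∃ u₁ u₂ v₁ v₂ : Site 2,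
        triNorm u₁ = r ∧ triNorm u₂ = r ∧ triNorm v₁ = R ∧ triNorm v₂ = R ∧
        PathIn triGraph ({v | (r:ℤ) ≤ triNorm v ∧ triNorm v ≤ R} ∩ ω) u₁ v₁ ∧ PathIn triGraph (… ∩ ω) u₂ v₂ ∧
        ¬ PathIn triGraph (… ∩ ω) u₁ u₂} ≤ C * ((r:ℝ)/R) ^ (1 + ε)`
   (the `𝕋` twin of `fourArmTwoClusters` / of the conclusion of `Garban2011_fourArm_multiscale`; centred annuli by
   `…SiteTranslation`).  Sources: Smirnov–Werner 2001 Thm 4 (`j = 4`) with Kesten 1987 / Nolin 2008 Prop. 17 give `5/4`;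
   the UNIFORM two-radius form follows from the ratio limit (16)₄ + (9)₄ (hypothesis `hA` of
   `fourArm_exponent_of_scalingLimit`; GPS 2013 Lemma 2.9) and `polyArmProb_submult` (bootstrap `π₄(r, K^j r) ≤ K^{-(1+2ε)j}`
   for `r ≥ ρ₀(K)`) — a fixed-inner-radius exponent statement such as `fourArm_exponent` does NOT suffice; RSW-only:
   Schramm–Smirnov 2011 Appendix B (Garban; printed for bond `ℤ²`, PROVED in tree as `Garban2011_fourArm_multiscale_holds`),
   van den Berg–Nolin, arXiv 2008.01606, Thm. 1 (printed for `ℤ²`; lattice-robust).  (I1) one-arm RSW bound — IN TREE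
   (`exists_polyArmProb_one_le_rpow`).  (IRSW) circuits in ratio-2 annuli — IN TREE.  (I0) positivity of `TPinch` at ratio 2
   — ABSENT (RSW).  The half-plane three-arm bound (`LawlerSchrammWerner2002_halfPlane_threeArm`, PROVED) and six-arm bounds
   are NOT needed in this organisation.
5. DEAD ENDS recorded: (a) union bounds over single bad links without following the chain to `C(O₂)` are not summable
   (`(s/lam)(ℓ/lam)^{1/4} π₁(lam,s)` may exceed 1 in the window); (b) "wired at resolution ℓ" fuzzy interiors over-connect
   (adjacent cells are joined by sub-`ℓ` interior clusters with probability `→ 1` as `ℓ → ∞`), so a wired `Hook*` is `≈`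
   always true; (c) closing small blobs one at a time yields arms with an UNBOUNDED number of defects (Nolin 2008 Prop. 18
   does not apply); (d) first-order influences of small blobs are summable (`(lam/s)^{α₄-1}`) but do not control joint
   pivotality.
-/

noncomputable section

namespace Summit.CriticalPhenomena.CardyFormulaZ2.Cruxes.NestingRigidity.PinchResampling

open MeasureTheory Set Literature.Probability.Percolation Literature.Probability.LatticeModels
open scoped symmDiff

section HookStar

/-- The interior open sites of the ball `Λ_s(x)` that **touch** the set of cells `S` (grid of mesh `ℓ`, origin `o`):
`u` is open, in the ball, and `𝕋`-adjacent to an inner-layer vertex of the collar whose cell lies in `S`.  (Fuzzy attachment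
at resolution `ℓ`: the inner-layer vertex need not be open, let alone belong to the blob whose footprint `S` is.) -/
def touchers (ℓ s : ℕ) (x o : Site 2) (η : SiteConfig (Site 2)) (S : Set (Site 2)) : Set (Site 2) :=
  {u | u ∈ η ∧ u ∈ tBall x s ∧ ∃ w ∈ innerLayer triGraph (tBall x s) (tBall x (2 * s)), triGraph.Adj u w ∧ cellOf ℓ o w ∈ S}

/-- The edges of the **fuzzy interior graph** (as a set of ordered pairs): two interior open sites are linked if they are
`𝕋`-adjacent, or if they touch a common coarse footprint of a big blob (crossing or not) of the datum `σ`. -/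
def starPairs (ℓ s : ℕ) (x o : Site 2) (σ : Set (Set (Site 2)) × Set (Set (Site 2))) (η : SiteConfig (Site 2)) :
    Set (Site 2 × Site 2) :=
  {q | (q.1 ∈ η ∧ q.1 ∈ tBall x s ∧ q.2 ∈ η ∧ q.2 ∈ tBall x s ∧ triGraph.Adj q.1 q.2) ∨
    ∃ S ∈ σ.1 ∪ σ.2, q.1 ∈ touchers ℓ s x o η S ∧ q.2 ∈ touchers ℓ s x o η S}

/-- **The fuzzy hook-up `Hook*`** of the ball `Λ_s(x)` through the big blobs of its collar: every two coarse footprints of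
big CROSSING blobs are joined by a chain of interior open sites, consecutive ones `𝕋`-adjacent or touching a common big
footprint.  By construction it reads the configuration only through the interior sites and the coarse datum
(`tHookStar_factor`); on `TPinch` it is the candidate approximation of `THook x x s s` of the S11 proof plan
(`S10-typing.md` §2: `Hook ∆ Hook* ⊆` four-arm events at boundary cells ∪ small-blob bridges ∪ footprint-end events). -/
def THookStar (ℓ lam s : ℕ) (x o : Site 2) : Set (SiteConfig (Site 2)) :=
  {η | ∀ S ∈ (tCoarse ℓ lam s x o η).1, ∀ S' ∈ (tCoarse ℓ lam s x o η).1,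
    ∃ u ∈ touchers ℓ s x o η S, ∃ u' ∈ touchers ℓ s x o η S',
      Relation.ReflTransGen (fun a b ↦ (a, b) ∈ starPairs ℓ s x o (tCoarse ℓ lam s x o η) η) u u'}

/-- Touching reads only the interior. -/
theorem touchers_congr (ℓ s : ℕ) (x o : Site 2) {η η' : SiteConfig (Site 2)} (h : η ∩ tBall x s = η' ∩ tBall x s)
    (S : Set (Site 2)) : touchers ℓ s x o η S = touchers ℓ s x o η' S := by
  ext u
  simp only [touchers, mem_setOf_eq]
  constructor
  · rintro ⟨hu, huK, hw⟩
    exact ⟨((Set.ext_iff.1 h u).1 ⟨hu, huK⟩).1, huK, hw⟩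
  · rintro ⟨hu, huK, hw⟩
    exact ⟨((Set.ext_iff.1 h u).2 ⟨hu, huK⟩).1, huK, hw⟩

/-- The fuzzy edges read only the interior and the datum. -/
theorem starPairs_congr (ℓ s : ℕ) (x o : Site 2) (σ : Set (Set (Site 2)) × Set (Set (Site 2)))
    {η η' : SiteConfig (Site 2)} (h : η ∩ tBall x s = η' ∩ tBall x s) :
    starPairs ℓ s x o σ η = starPairs ℓ s x o σ η' := by
  have key : ∀ v ∈ tBall x s, (v ∈ η ↔ v ∈ η') := fun v hv ↦
    ⟨fun hη ↦ ((Set.ext_iff.1 h v).1 ⟨hη, hv⟩).1, fun hη ↦ ((Set.ext_iff.1 h v).2 ⟨hη, hv⟩).1⟩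
  ext q
  simp only [starPairs, touchers_congr ℓ s x o h, mem_setOf_eq]
  constructor
  · rintro (⟨hu, huK, hu', hu'K, hadj⟩ | hS)
    · exact Or.inl ⟨(key _ huK).1 hu, huK, (key _ hu'K).1 hu', hu'K, hadj⟩
    · exact Or.inr hS
  · rintro (⟨hu, huK, hu', hu'K, hadj⟩ | hS)
    · exact Or.inl ⟨(key _ huK).2 hu, huK, (key _ hu'K).2 hu', hu'K, hadj⟩
    · exact Or.inr hS

/-- **`Hook*` factors through (interior, coarse datum).** -/
theorem tHookStar_factor (ℓ lam s : ℕ) (x o : Site 2) : ∀ η η' : SiteConfig (Site 2), η ∩ tBall x s = η' ∩ tBall x s →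
    tCoarse ℓ lam s x o η = tCoarse ℓ lam s x o η' → (η ∈ THookStar ℓ lam s x o ↔ η' ∈ THookStar ℓ lam s x o) := by
  intro η η' hI hσ
  simp only [THookStar, mem_setOf_eq, hσ, touchers_congr ℓ s x o hI,
    starPairs_congr ℓ s x o (tCoarse ℓ lam s x o η') hI]

/-- **S11 from the approximation quality of `Hook*`**: if, in the scale window, `P(TPinch ∩ (THook ∆ THookStar)) ≤ b² P(TPinch)`
(the content of bricks B3 + arm sums), then `NeckHookupCoarseT`. -/
theorem neckHookupCoarseT_of_tHookStar : (∀ b : ℝ, 0 < b → ∃ L : ℕ, ∀ (x o : Site 2) (ℓ lam s : ℕ), 1 ≤ ℓ → s ^ 3 * ℓ ≤ lam ^ 4 → L * lam ≤ s → (triSitePercolation half).real (TPinch x x s s ∩ symmDiff (THook x x s s) (THookStar ℓ lam s x o)) ≤ b ^ 2 * (triSitePercolation half).real (TPinch x x s s)) → NeckHookupCoarseT := by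
  intro h
  refine neckHookupCoarseT_of_approx fun b hb ↦ ?_
  obtain ⟨L, hL⟩ := h b hb
  exact ⟨L, fun x o ℓ lam s hℓ hw hs ↦ ⟨THookStar ℓ lam s x o, tHookStar_factor ℓ lam s x o, hL x o ℓ lam s hℓ hw hs⟩⟩

end HookStar

end Summit.CriticalPhenomena.CardyFormulaZ2.Cruxes.NestingRigidity.PinchResampling

end
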